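import Mathlib
import Summits.Schanuel.Schanuel.Theses.RigidCore
import Literature.NumberTheory.Transcendental.ZilberField
import Literature.NumberTheory.Transcendental.ZilberFieldExistenceProofs
import Literature.NumberTheory.Transcendental.PseudoExpAmbient

/-!
# Crux `AclSubsetLogFreeCore` — calibration of the reshaped line's hypotheses (drefute gen 3)

Line `eac-extends-core-automorphisms`, skeleton 6f962234 (lead prover-line-stmt-Schanuel-0968-1, 2026-08-16):
the residue (A₀) is attacked under the standing hypothesis `stub_zilber : IsZilberField ℂ`, and every
engine stub (`stub_doubleModel`, `stub_realiseCopy`, `hullToCore`, the doubling principle `hD` of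
`stub_caseI`) carries a BASE-STRONGNESS hypothesis
`hX : GammaField.IsStrong (span ℚ {2πi} ⊔ span ℚ (range c))` for a finite tuple `c` of `ℂ`.

Two unconditional, kernel-checked calibration facts for planners and later refuters:

* `isStrong_span_two_pi_I_iff_schanuelProperty` — strongness of the kernel line `ℚ·2πi ◁ ℂ_exp` IS
  Schanuel's conjecture (`SchanuelProperty ℂ`, to which the summit `Schanuel` unfolds by `Iff.rfl`);
  Bays–Kirby 2018 Thm 9.1 (proof), tree `schanuelProperty_iff_isStrong_span_kernelGenerator`.
* `isStrong_doublingBase_nil_iff_schanuelProperty` — hence the hypothesis `hX` of the doubling engine at the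
  EMPTY tuple `c = Fin.elim0` (the case `U* = Λ₀` of Case I, e.g. for a root of `eˣ + x = 0`) is literally
  Schanuel's conjecture; and `schanuelProperty_of_isZilberField` — the standing hypothesis contains it.

Reading: the engine is sound, but its fuel is the Schanuel property of `ℂ_exp` on hulls inside `ecl ∅`
(which is all of SC by Kirby's localisation `schanuelConjecture_iff_ecl_empty_holds`); a proof of the crux
(A) through this skeleton is a proof of `ZilberConjecture ∧ [Case II] → (A)`, i.e. a CONSISTENCY /
calibration theorem for (A) relative to Zilber's conjecture ("refuting (A) refutes ZC"), not progress of the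
route `MinimalCounterexampleInAcl → AclSubsetLogFreeCore → SchanuelOnLogFreeCore → Schanuel` toward the summit.
-/

noncomputable section

set_option linter.dupNamespace false

open Literature.ModelTheory.ExponentialFields Literature.NumberTheory.Transcendental

namespace Summit.Schanuel.Schanuel.Theorems.AclSubsetLogFreeCore.Negative

/-- **`ℚ·2πi ◁ ℂ_exp` is Schanuel's conjecture.**  Strongness (Bays–Kirby Def. 4.3, tree
`GammaField.IsStrong`: every finitely generated extension has predimension `δ ≥ 0`) of the `ℚ`-line
spanned by the kernel generator `2πi` inside `ℂ_exp` is equivalent to the Schanuel property of `ℂ_exp`. -/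
theorem isStrong_span_two_pi_I_iff_schanuelProperty :
    GammaField.IsStrong (Submodule.span ℚ ({(2 * ↑Real.pi * Complex.I : ℂ)} : Set ℂ)) ↔
      SchanuelProperty ℂ :=
  (schanuelProperty_iff_isStrong_span_kernelGenerator (F := ℂ) PseudoExpAmbient.transcendental_twoPiI
    (by show Complex.exp (2 * ↑Real.pi * Complex.I) = 1; exact Complex.exp_two_pi_mul_I)).symm

/-- **The doubling engine's base hypothesis at the empty tuple is Schanuel's conjecture.**  The
hypothesis `hX : IsStrong (span ℚ {τ} ⊔ span ℚ (range c))` of `stub_doubleModel` / `stub_realiseCopy` /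
`hullToCore` / `hD` (skeleton 6f962234 of line `eac-extends-core-automorphisms`), at `τ = 2πi` and
`c = Fin.elim0`, is equivalent to `SchanuelProperty ℂ`. -/
theorem isStrong_doublingBase_nil_iff_schanuelProperty :
    GammaField.IsStrong (Submodule.span ℚ ({(2 * ↑Real.pi * Complex.I : ℂ)} : Set ℂ) ⊔
      Submodule.span ℚ (Set.range (Fin.elim0 : Fin 0 → ℂ))) ↔ SchanuelProperty ℂ := by
  rw [Set.range_eq_empty (Fin.elim0 : Fin 0 → ℂ), Submodule.span_empty, sup_bot_eq]
  exact isStrong_span_two_pi_I_iff_schanuelProperty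

/-- **The reshaped line's standing hypothesis contains the Schanuel property of `ℂ_exp`** (a field
projection of `IsZilberField`; recorded here so that the calibration is importable by name). -/
theorem schanuelProperty_of_isZilberField (h : IsZilberField ℂ) : SchanuelProperty ℂ :=
  h.schanuelProperty

/-- Consequently the base hypothesis of the doubling engine at the empty tuple holds under the line's
standing hypothesis — and, by `isStrong_doublingBase_nil_iff_schanuelProperty`, ONLY together with the
Schanuel property. -/
theorem isStrong_doublingBase_nil_of_isZilberField (h : IsZilberField ℂ) :
    GammaField.IsStrong (Submodule.span ℚ ({(2 * ↑Real.pi * Complex.I : ℂ)} : Set ℂ) ⊔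
      Submodule.span ℚ (Set.range (Fin.elim0 : Fin 0 → ℂ))) :=
  isStrong_doublingBase_nil_iff_schanuelProperty.2 h.schanuelProperty

end Summit.Schanuel.Schanuel.Theorems.AclSubsetLogFreeCore.Negative
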